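import Mathlib
import Summits.AtomisticToContinuum.Crystallization.Theorems.ChartedZeroExcessLayeredLatticeLiouvilleWindowPoincareMaps

/-!
# Tools for (P) `WindowPoincareP 1` (decomp-a2c hand-1 g17): fibre-bounded sums, the grid of spacing `1/4`, rounding, uniform packing

Generic helpers for `…LatticeLiouvilleWindowPoincare.windowPoincareP_one`: the fibre-counting sum inequality
`Σ_{a∈T} f (g a) ≤ M · Σ_{b} f b`, integer windows, the vectors `mk3 a b c` and grid points `gridPos m i j k` (spacing `1/4`,
`2m+1` points per side, centred), rounding to the grid (`roundIdx`, `exists_gridPos_near`), and the translated form of the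
uniform packing bound for `δ`-separated sets (`card_le_of_sep_ball`).
-/

noncomputable section

open scoped BigOperators
open MeasureTheory Set Metric Finset
open Summit.AtomisticToContinuum.Crystallization.Theorems.ChartedZeroExcessLayeredLatticeLiouvilleWindowPoincare

namespace Summit.AtomisticToContinuum.Crystallization.Theorems.ChartedZeroExcessLayeredLatticeLiouville

/-! ## 1. Small generic tools -/

/-- sum over a map with bounded fibres: `Σ_{a∈T} f (g a) ≤ M · Σ_{b∈B} f b` for `f ≥ 0` on `B ⊇ g(T)`. [folklore] -/
theorem sum_comp_le_of_fiber_le {α β : Type*} [DecidableEq β] (T : Finset α) (B : Finset β) (g : α → β) (f : β → ℝ)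
    (M : ℕ) (hg : ∀ a ∈ T, g a ∈ B) (hf : ∀ b ∈ B, 0 ≤ f b)
    (hM : ∀ b ∈ B, (T.filter (fun a => g a = b)).card ≤ M) :
    ∑ a ∈ T, f (g a) ≤ M * ∑ b ∈ B, f b := by
  rw [← Finset.sum_fiberwise_of_maps_to hg (f := fun a => f (g a)), Finset.mul_sum]
  refine Finset.sum_le_sum fun b hb => ?_
  calc ∑ a ∈ T.filter (fun a => g a = b), f (g a) = ∑ a ∈ T.filter (fun a => g a = b), f b :=
        Finset.sum_congr rfl fun a ha => by rw [(Finset.mem_filter.1 ha).2]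
    _ = ((T.filter (fun a => g a = b)).card : ℝ) * f b := by rw [Finset.sum_const, nsmul_eq_mul]
    _ ≤ M * f b := by
        have h1 : ((T.filter (fun a => g a = b)).card : ℝ) ≤ M := by exact_mod_cast hM b hb
        exact mul_le_mul_of_nonneg_right h1 (hf b hb)

/-- a finite set of naturals inside a real window of length `77` has at most `78` elements. [folklore] -/
theorem card_le_of_window (A : Finset ℕ) (t : ℝ) (h : ∀ i ∈ A, t < i ∧ (i : ℝ) < t + 77) : A.card ≤ 78 := by
  set b := ⌊max 0 t⌋₊ with hb
  have hsub : A ⊆ Finset.Ico b (b + 78) := by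
    intro i hi
    obtain ⟨h1, h2⟩ := h i hi
    rw [Finset.mem_Ico]
    have hb0 : (b : ℝ) ≤ max 0 t := Nat.floor_le (le_max_left _ _)
    have hb1 : max 0 t < b + 1 := Nat.lt_floor_add_one _
    constructor
    · have : (b : ℝ) ≤ i := by
        rcases le_or_gt t 0 with ht | ht
        · rw [max_eq_left ht] at hb0
          exact hb0.trans (Nat.cast_nonneg i)
        · rw [max_eq_right ht.le] at hb0
          exact hb0.trans h1.le
      exact_mod_cast this
    · have : (i : ℝ) < b + 78 := by
        have : t ≤ max 0 t := le_max_right _ _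
        linarith
      exact_mod_cast this
  exact (Finset.card_le_card hsub).trans (by simp)

/-- the rounding index `⌊4t + m + 1/2⌋₊`. -/
def roundIdx (m : ℕ) (t : ℝ) : ℕ := ⌊4 * t + m + 1 / 2⌋₊

/-- the rounding index lies in `{0,…,2m}`. [folklore] -/
theorem roundIdx_lt {m : ℕ} {t : ℝ} (h : |t| ≤ (m : ℝ) / 4) : roundIdx m t < 2 * m + 1 := by
  have h1 := (abs_le.1 h).2
  have hnn : 0 ≤ 4 * t + m + 1 / 2 := by have := (abs_le.1 h).1; linarith
  have : (roundIdx m t : ℝ) ≤ 4 * t + m + 1 / 2 := Nat.floor_le hnn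
  have : (roundIdx m t : ℝ) < 2 * m + 1 := by linarith
  exact_mod_cast this

/-- the rounded grid coordinate is within `1/8`. [folklore] -/
theorem abs_roundIdx_sub_le {m : ℕ} {t : ℝ} (h : |t| ≤ (m : ℝ) / 4) :
    |(roundIdx m t : ℝ) / 4 - m / 4 - t| ≤ 1 / 8 := by
  have hnn : 0 ≤ 4 * t + m + 1 / 2 := by have := (abs_le.1 h).1; linarith
  have h1 : (roundIdx m t : ℝ) ≤ 4 * t + m + 1 / 2 := Nat.floor_le hnn
  have h2 : 4 * t + m + 1 / 2 < roundIdx m t + 1 := Nat.lt_floor_add_one _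
  rw [abs_le]; constructor <;> linarith

/-- the vector of `ℝ³` with coordinates `(a, b, c)`. -/
def mk3 (a b c : ℝ) : (EuclideanSpace ℝ (Fin 3)) :=
  a • EuclideanSpace.single 0 (1 : ℝ) + b • EuclideanSpace.single 1 (1 : ℝ) + c • EuclideanSpace.single 2 (1 : ℝ)

/-- first coordinate of `mk3`. -/
@[simp] theorem mk3_apply_zero (a b c : ℝ) : mk3 a b c 0 = a := by simp [mk3]
/-- second coordinate of `mk3`. -/
@[simp] theorem mk3_apply_one (a b c : ℝ) : mk3 a b c 1 = b := by simp [mk3]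
/-- third coordinate of `mk3`. -/
@[simp] theorem mk3_apply_two (a b c : ℝ) : mk3 a b c 2 = c := by simp [mk3]

/-- sup norm of `mk3`. [folklore] -/
theorem linf_mk3_le {a b c r : ℝ} (ha : |a| ≤ r) (hb : |b| ≤ r) (hc : |c| ≤ r) : linf (mk3 a b c) ≤ r := by
  unfold linf
  rw [mk3_apply_zero, mk3_apply_one, mk3_apply_two]
  exact max_le ha (max_le hb hc)

/-- coordinates determine the vector. [folklore] -/
theorem eq_mk3 (x : (EuclideanSpace ℝ (Fin 3))) : x = mk3 (x 0) (x 1) (x 2) := by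
  ext i; fin_cases i <;> simp

/-- difference of two `mk3`. [folklore] -/
theorem mk3_sub (a b c a' b' c' : ℝ) : mk3 a b c - mk3 a' b' c' = mk3 (a - a') (b - b') (c - c') := by
  ext i; fin_cases i <;> simp

/-- the grid point `(i, j, k)` of the grid of spacing `1/4` centred at the origin with `2m+1` points per side. -/
def gridPos (m i j k : ℕ) : (EuclideanSpace ℝ (Fin 3)) := mk3 ((i : ℝ) / 4 - m / 4) ((j : ℝ) / 4 - m / 4) ((k : ℝ) / 4 - m / 4)

/-- grid points lie in the cube of half-side `m/4`. [folklore] -/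
theorem linf_gridPos_le {m i j k : ℕ} (hi : i < 2 * m + 1) (hj : j < 2 * m + 1) (hk : k < 2 * m + 1) :
    linf (gridPos m i j k) ≤ (m : ℝ) / 4 := by
  have h : ∀ l : ℕ, l < 2 * m + 1 → |(l : ℝ) / 4 - m / 4| ≤ (m : ℝ) / 4 := by
    intro l hl
    have hl' : (l : ℝ) ≤ 2 * m := by exact_mod_cast Nat.lt_succ_iff.1 hl
    rw [abs_le]; constructor <;> [linarith [Nat.cast_nonneg (α := ℝ) l]; linarith]
  exact linf_mk3_le (h i hi) (h j hj) (h k hk)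

/-- neighbouring grid points are `≤ 1/2` apart (first coordinate). [folklore] -/
theorem norm_gridPos_succ₁ (m i j k : ℕ) : ‖gridPos m (i + 1) j k - gridPos m i j k‖ ≤ 1 / 2 := by
  rw [gridPos, gridPos, mk3_sub]
  refine (norm_le_two_linf _).trans ?_
  have : linf (mk3 (((i + 1 : ℕ) : ℝ) / 4 - m / 4 - ((i : ℝ) / 4 - m / 4)) ((j : ℝ) / 4 - m / 4 - ((j : ℝ) / 4 - m / 4))
      ((k : ℝ) / 4 - m / 4 - ((k : ℝ) / 4 - m / 4))) ≤ 1 / 4 := by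
    refine linf_mk3_le ?_ ?_ ?_
    · push_cast; rw [abs_le]; constructor <;> linarith
    · simp
    · simp
  linarith

/-- neighbouring grid points are `≤ 1/2` apart (second coordinate). [folklore] -/
theorem norm_gridPos_succ₂ (m i j k : ℕ) : ‖gridPos m i (j + 1) k - gridPos m i j k‖ ≤ 1 / 2 := by
  rw [gridPos, gridPos, mk3_sub]
  refine (norm_le_two_linf _).trans ?_
  have : linf (mk3 (((i : ℕ) : ℝ) / 4 - m / 4 - ((i : ℝ) / 4 - m / 4)) (((j + 1 : ℕ) : ℝ) / 4 - m / 4 - ((j : ℝ) / 4 - m / 4))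
      ((k : ℝ) / 4 - m / 4 - ((k : ℝ) / 4 - m / 4))) ≤ 1 / 4 := by
    refine linf_mk3_le ?_ ?_ ?_
    · simp
    · push_cast; rw [abs_le]; constructor <;> linarith
    · simp
  linarith

/-- neighbouring grid points are `≤ 1/2` apart (third coordinate). [folklore] -/
theorem norm_gridPos_succ₃ (m i j k : ℕ) : ‖gridPos m i j (k + 1) - gridPos m i j k‖ ≤ 1 / 2 := by
  rw [gridPos, gridPos, mk3_sub]
  refine (norm_le_two_linf _).trans ?_
  have : linf (mk3 (((i : ℕ) : ℝ) / 4 - m / 4 - ((i : ℝ) / 4 - m / 4)) (((j : ℕ) : ℝ) / 4 - m / 4 - ((j : ℝ) / 4 - m / 4))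
      (((k + 1 : ℕ) : ℝ) / 4 - m / 4 - ((k : ℝ) / 4 - m / 4))) ≤ 1 / 4 := by
    refine linf_mk3_le ?_ ?_ ?_
    · simp
    · simp
    · push_cast; rw [abs_le]; constructor <;> linarith
  linarith

/-- rounding a point of the cube of half-side `m/4` to the grid: indices in range and distance `≤ 1/4`. [folklore] -/
theorem exists_gridPos_near {m : ℕ} {q : (EuclideanSpace ℝ (Fin 3))} (hq : linf q ≤ (m : ℝ) / 4) :
    roundIdx m (q 0) < 2 * m + 1 ∧ roundIdx m (q 1) < 2 * m + 1 ∧ roundIdx m (q 2) < 2 * m + 1 ∧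
      ‖gridPos m (roundIdx m (q 0)) (roundIdx m (q 1)) (roundIdx m (q 2)) - q‖ ≤ 1 / 4 := by
  have h0 : |q 0| ≤ (m : ℝ) / 4 := (abs_apply_le_linf q 0).trans hq
  have h1 : |q 1| ≤ (m : ℝ) / 4 := (abs_apply_le_linf q 1).trans hq
  have h2 : |q 2| ≤ (m : ℝ) / 4 := (abs_apply_le_linf q 2).trans hq
  refine ⟨roundIdx_lt h0, roundIdx_lt h1, roundIdx_lt h2, ?_⟩
  have e : gridPos m (roundIdx m (q 0)) (roundIdx m (q 1)) (roundIdx m (q 2)) - q =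
      mk3 ((roundIdx m (q 0) : ℝ) / 4 - m / 4 - q 0) ((roundIdx m (q 1) : ℝ) / 4 - m / 4 - q 1)
        ((roundIdx m (q 2) : ℝ) / 4 - m / 4 - q 2) := by
    ext i; fin_cases i <;> simp [gridPos]
  rw [e]
  refine (norm_le_two_linf _).trans ?_
  have : linf (mk3 ((roundIdx m (q 0) : ℝ) / 4 - m / 4 - q 0) ((roundIdx m (q 1) : ℝ) / 4 - m / 4 - q 1)
      ((roundIdx m (q 2) : ℝ) / 4 - m / 4 - q 2)) ≤ 1 / 8 :=
    linf_mk3_le (abs_roundIdx_sub_le h0) (abs_roundIdx_sub_le h1) (abs_roundIdx_sub_le h2)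
  linarith

/-- uniform packing in translated balls: if every `δ`-separated set has `≤ C` points in `B̄(0, r)`, then a finite set of points of a
`δ`-separated `S` within `r` of any centre `w` has `≤ C` elements. [folklore] -/
theorem card_le_of_sep_ball {δ r : ℝ} {C : ℕ}
    (hC : ∀ S' : Set (EuclideanSpace ℝ (Fin 3)), (∀ x ∈ S', ∀ y ∈ S', x ≠ y → δ ≤ dist x y) → (closedBall (0 : (EuclideanSpace ℝ (Fin 3))) r ∩ S').encard ≤ C)
    {S : Set (EuclideanSpace ℝ (Fin 3))} (hS : ∀ x ∈ S, ∀ y ∈ S, x ≠ y → δ ≤ dist x y) (w : (EuclideanSpace ℝ (Fin 3))) (F : Finset (EuclideanSpace ℝ (Fin 3)))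
    (hF : ∀ x ∈ F, x ∈ S ∧ dist x w ≤ r) : F.card ≤ C := by
  classical
  set S' : Set (EuclideanSpace ℝ (Fin 3)) := (fun p => p - w) '' S with hS'def
  have hS' : ∀ x ∈ S', ∀ y ∈ S', x ≠ y → δ ≤ dist x y := by
    rintro _ ⟨x, hx, rfl⟩ _ ⟨y, hy, rfl⟩ hne
    have hxy : x ≠ y := fun h => hne (by rw [h])
    have : dist (x - w) (y - w) = dist x y := by rw [dist_eq_norm, dist_eq_norm, sub_sub_sub_cancel_right]
    rw [this]; exact hS x hx y hy hxy
  have hsub : ((F.image (fun p => p - w) : Finset (EuclideanSpace ℝ (Fin 3))) : Set (EuclideanSpace ℝ (Fin 3))) ⊆ closedBall (0 : (EuclideanSpace ℝ (Fin 3))) r ∩ S' := by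
    intro z hz
    rw [Finset.coe_image] at hz
    obtain ⟨x, hx, rfl⟩ := hz
    obtain ⟨hxS, hxw⟩ := hF x hx
    refine ⟨?_, ⟨x, hxS, rfl⟩⟩
    rw [mem_closedBall, dist_zero_right, ← dist_eq_norm]; exact hxw
  have h1 : ((F.image (fun p => p - w)).card : ℕ∞) ≤ C := by
    rw [← Set.encard_coe_eq_coe_finsetCard]
    exact (Set.encard_le_encard hsub).trans (hC S' hS')
  rw [Finset.card_image_of_injective _ sub_left_injective] at h1
  exact_mod_cast h1

/-- `‖a‖ ≤ r + s` from `‖b‖ ≤ r` and `dist a b ≤ s`. [folklore] -/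
theorem norm_le_of_dist_le {a b : (EuclideanSpace ℝ (Fin 3))} {r s : ℝ} (hb : ‖b‖ ≤ r) (hd : dist a b ≤ s) : ‖a‖ ≤ r + s := by
  have e : b + (a - b) = a := by abel
  rw [dist_eq_norm] at hd
  calc ‖a‖ = ‖b + (a - b)‖ := by rw [e]
    _ ≤ ‖b‖ + ‖a - b‖ := norm_add_le _ _
    _ ≤ r + s := add_le_add hb hd

/-- window membership of an index from a coordinate bound. [folklore] -/
theorem idx_window {m i : ℕ} {q g : ℝ} (hg : g = (i : ℝ) / 4 - m / 4) (h : |q - g| ≤ 48 / 5) :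
    4 * q + m - 385 / 10 < i ∧ (i : ℝ) < 4 * q + m - 385 / 10 + 77 := by
  rw [hg, abs_le] at h
  constructor <;> linarith [h.1, h.2]

end Summit.AtomisticToContinuum.Crystallization.Theorems.ChartedZeroExcessLayeredLatticeLiouville
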